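import Summits.QuantumFields.YangMills.Theorems.FluctuationComparisonRegPrIntLS2BetaLiftLadderOneProfileTop
import Summits.QuantumFields.YangMills.Theorems.FluctuationComparisonRegPrIntLS2BetaTorusCellClasses
import HarnessLib

/-!
# S2β · THE SUP CHAIN — BLOCK-PAIR READ COVER ((k2)): `Σ_B ‖𝟙[BOX_t(B)]·f‖² ≤ (2·d·7^d)·Σ_B ‖𝟙[READ′_t(B)]·f‖²` for every bond function `f`
# at level `J+t+1` — the `δC`-column of the W-ρκ letter is an `S′`-share (`Σ_B δC(t,B)² ≤ C_adj·E′lam t`)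

Cell `ym3-torus` (YM ladder rung R3 = continuum `SU(2)` Yang–Mills on the three-torus at fixed lattice data — a RUNG: NOT d = 4, NOT infinite volume,
NOT a mass gap, NOT Clay).  Width seat «width 21» `ym3-torus-px21` (gen 25), FREE px helper on crux `stmt-QuantumFields-20520`
(`…Theses.UnitScaleTilt.FluctuationComparisonRegPrIntL`), LINE g18-1 S2β.  ARCHITECT px17 g22 2026-08-31 22:05:02Z ∕ 22:05:54Z NAMED this as §1 of px21's pen
(α) «the `hX′` assembler» (the (SRC′) inhabitant of ✓p835564 `hSCT_of_discSplit'`).  `--kind proof --supports stmt-QuantumFields-20520 --as helper`,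
count-neutral, DEFINITION-FREE (0 `def`, 0 `instance`, 0 `notation`, 0 `sorry`, default heartbeats).

WHY.  px16 g24's W-ρκ letter γ (`…S2BetaKappaRatioTower.hκrel_of_regionLetters`) exhibits `ρκ := 12ℓ²((ρP + 4a·δC) + 2a(ℓ·δC))` with `δC(t,B)` a bound for
the relative stage chords on the BLOCK-PAIR BOX of the `READ′_t(B)` bonds (the block of a read bond and its two neighbours along the bond's direction); in
px20's ✓∕⧗`discRow'` the `a²·δC²` column of `X t` must therefore be paid by the READ energy `E′lam t = Σ_B ‖𝟙[READ′_t(B)]·η‖²` (a `β_X·S′`-share, since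
`discRow'` has `q := 0`).  The box sticks out of `READ′_t(B)` (thickness 2), but every box bond is READ by a neighbouring top bond: this file proves the
finite double count, for an ARBITRARY bond function `f` (so it instantiates to the station's relative log field by `exact`, and to any other currency).

WHAT IS PROVED (sorry-free).
§1 torus bookkeeping (generic `Params`): `natAbs_rel_shift_le_one` ∕ `natAbs_rel_unshift_le_one` (one lattice step is distance `≤ 1` in least-absolute-value
   representatives), `natAbs_rel_of_boxBlock`, ★`natAbs_rel_blockIter_le_three_of_box` (a block-pair box around a thickness-2 read bond is within `3` blocks at
   every coarser generation: ✓`natAbs_rel_blockOf_le` + triangle ✓`natAbs_rel_le_add` + ✓`natAbs_rel_blockIter_mono`), ★`card_bonds_nearBox_le` (at most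
   `2·d·(2τ+1)^d` bonds have an endpoint in a `|rel| ≤ τ` box: ✓`card_box_le` for sources and targets).
§2 ★★★`sum_sq_boxSup_le_readSup` — THE COVER: `Σ_B ‖𝟙[BOX_t(B)]·f‖² ≤ (2·d·7^d)·Σ_B ‖𝟙[READ′_t(B)]·f‖²`, `READ′_t(B)` = the stations' text VERBATIM
   (✓p830803∕✓p831146∕✓p834059: `∃ z, blockIter (t+1) z ∈ {(σB).src, (σB).tgt} ∧ ∀ ν, |rel z ℓ′.src|_ν ≤ 2`), `BOX_t(B)(ℓ′) := ∃ ℓ″ ∈ READ′_t(B),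
   blockOf ℓ′.src ∈ {(blockOf ℓ″.src) − e_{dir ℓ″}, blockOf ℓ″.src, (blockOf ℓ″.src) + e_{dir ℓ″}}` (px16 γ's ∕ px20's box at level `J+t+1`; the height-`s` edition
   through `σ₂` is one `siteShift_blockOf` away, done in (α)).  Mechanism: a box bond `ℓ′` is read by `B′ := ⟨σ⁻¹(blockIter (t+1) ℓ′.src), 0⟩` (witness `z := ℓ′.src`),
   which is within sup-distance `3` of an endpoint of `B` (§1); so the box sup is `≤ (Σ_{B′ adjacent} ‖𝟙[READ′_t(B′)]·f‖²)^{1∕2}`, and each `B′` is adjacent to at most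
   `2·d·7^d` bonds `B` (`d = 3`: `2058`; the constant multiplies the θ-small `a²` of the W-ρκ letter, so its size is immaterial).

HONEST SCOPE.  Finite torus bookkeeping; nothing of Bałaban's renormalisation-group analysis is asserted or proved ([Balaban1987RG1] (0.1)–(0.4) pp.251–253 are the
printed lattice conventions; [Balaban1985Averaging] Prop. 4 (128)–(135) the sup recursion the stations transcribe); the W-ρκ letter's other columns, (SPLIT), (SRC′),
`hArc`, (ST‴)∕LOC‴, GAP♯∘ (`stub_uniformFibreGapOrbit`, registry 3732b7df UNTOUCHED), the five registered stubs (0∕5), S2β, 20520, 19936, 19200, `YM3TorusSU2`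
are NOT proved; no registered stub is closed; rung R3 — NOT d = 4, NOT infinite volume, NOT a mass gap, NOT Clay; the Yang–Mills mass gap is NOT proved.
-/

set_option autoImplicit false

namespace Summit.QuantumFields.YangMills.Theorems.FluctuationComparisonRegPrIntLS2BetaBlockPairReadCover

open Finset
open Literature.MathematicalPhysics.QuantumFieldTheory.Balaban1983to89
open T4Continuum T3ContinuumYM3Torus T3TiltDescent T3LevelShift BlockAveraging
open B10Eq27TorusAxialLog (rel rel_apply rel_self)
open B10StarCount (unshift_shift)
open Summit.QuantumFields.YangMills.Theorems.StrongCouplingShape (natAbs_valMinAbs_intCast_le)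
open Summit.QuantumFields.YangMills.Theorems.FluctuationComparisonRegPrIntLS2BetaReadNesting (natAbs_rel_le_add natAbs_rel_comm)
open Summit.QuantumFields.YangMills.Theorems.FluctuationComparisonRegPrIntLS2BetaTorusCellClasses (natAbs_rel_blockOf_le natAbs_rel_blockIter_mono card_box_le)
open Summit.QuantumFields.YangMills.Theorems.FluctuationComparisonRegPrIntLS2BetaLiftLadderCombRowTower (natAbs_rel_siteShift)

/-! ## §1 Torus bookkeeping: one step is distance `≤ 1`; a block-pair box around a thickness-2 read bond is within `3` blocks -/

section Torus

variable {P : Params} {j : ℕ}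

/-- `|rel y (y + e_μ)|_ν ≤ 1` (least-absolute-value representatives; the wrap-around only shrinks). [folklore] -/
theorem natAbs_rel_shift_le_one (y : Site P j) (μ ν : Fin P.d) : (rel y (y.shift μ) ν).natAbs ≤ 1 := by
  rw [rel_apply]
  by_cases h : ν = μ
  · subst h
    have e : (y.shift ν) ν - y ν = ((1 : ℤ) : ZMod (P.sitesPerDir j)) := by
      simp [Site.shift, Function.update_self]
    rw [e]
    exact (natAbs_valMinAbs_intCast_le (1 : ℤ)).trans (by norm_num)
  · have e : (y.shift μ) ν - y ν = ((0 : ℤ) : ZMod (P.sitesPerDir j)) := by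
      simp [Site.shift, Function.update_of_ne h]
    rw [e]
    exact (natAbs_valMinAbs_intCast_le (0 : ℤ)).trans (by norm_num)

/-- `|rel y (y − e_μ)|_ν ≤ 1`. [folklore] -/
theorem natAbs_rel_unshift_le_one (y : Site P j) (μ ν : Fin P.d) : (rel y (y.unshift μ) ν).natAbs ≤ 1 := by
  rw [rel_apply]
  by_cases h : ν = μ
  · subst h
    have e : (y.unshift ν) ν - y ν = ((-1 : ℤ) : ZMod (P.sitesPerDir j)) := by
      simp [Site.unshift, Function.update_self]
    rw [e]
    exact (natAbs_valMinAbs_intCast_le (-1 : ℤ)).trans (by norm_num)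
  · have e : (y.unshift μ) ν - y ν = ((0 : ℤ) : ZMod (P.sitesPerDir j)) := by
      simp [Site.unshift, Function.update_of_ne h]
    rw [e]
    exact (natAbs_valMinAbs_intCast_le (0 : ℤ)).trans (by norm_num)

/-- The three blocks of a block-pair box are within `1` of the middle one. [folklore] -/
theorem natAbs_rel_of_boxBlock {k : ℕ} (b x : Site P k) (μ : Fin P.d)
    (h : x = b.unshift μ ∨ x = b ∨ x = b.shift μ) (ν : Fin P.d) : (rel b x ν).natAbs ≤ 1 := by
  rcases h with h | h | h
  · rw [h]; exact natAbs_rel_unshift_le_one b μ ν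
  · rw [h, rel_self]; simp
  · rw [h]; exact natAbs_rel_shift_le_one b μ ν

/-- ★ **A BLOCK-PAIR BOX AROUND A THICKNESS-2 READ BOND IS WITHIN `3` BLOCKS AT EVERY COARSER GENERATION**: if `|rel z x|_ν ≤ 2` for all `ν` and the block of
`x′` is the block of `x` or one of its two `μ`-neighbours, then `|rel (blockIter n z) (blockIter n x′)|_ν ≤ 3` for all `1 ≤ n ≤ m + K`
(`⌊·∕L⌋` is non-expansive on the torus, ✓`natAbs_rel_blockOf_le`, ✓`natAbs_rel_blockIter_mono`). [cite: Balaban1987RG1, (0.1)-(0.3) p.251-252] -/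
theorem natAbs_rel_blockIter_le_three_of_box {n : ℕ} (hn : 1 ≤ n) (hnK : n ≤ P.m + P.K) (z x x' : Site P 0) (μ : Fin P.d)
    (hz : ∀ ν, (rel z x ν).natAbs ≤ 2)
    (hbox : blockOf x' = (blockOf x).unshift μ ∨ blockOf x' = blockOf x ∨ blockOf x' = (blockOf x).shift μ) (ν : Fin P.d) :
    (rel (B14.Eq22Determines.blockIter n z) (B14.Eq22Determines.blockIter n x') ν).natAbs ≤ 3 := by
  have h01 : 0 + 1 ≤ P.m + P.K := by omega
  refine natAbs_rel_blockIter_mono hn hnK z x' ν ?_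
  show (rel (blockOf z) (blockOf x') ν).natAbs ≤ 3
  have h1 : (rel (blockOf z) (blockOf x) ν).natAbs ≤ 2 := natAbs_rel_blockOf_le h01 z x ν (hz ν)
  have h2 : (rel (blockOf x) (blockOf x') ν).natAbs ≤ 1 := natAbs_rel_of_boxBlock (blockOf x) (blockOf x') μ hbox ν
  calc (rel (blockOf z) (blockOf x') ν).natAbs ≤ (rel (blockOf z) (blockOf x) ν).natAbs + (rel (blockOf x) (blockOf x') ν).natAbs :=
        natAbs_rel_le_add _ _ _ ν
    _ ≤ 3 := by omega

/-- ★ **AT MOST `2·d·(2τ+1)^d` BONDS HAVE AN ENDPOINT IN A `|rel| ≤ τ` BOX** (✓`card_box_le` for the source and for the target). [folklore] -/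
theorem card_bonds_nearBox_le (c : Site P j) (τ : ℕ) :
    (univ.filter (fun B : PBond P j => (∀ ν, (rel B.src c ν).natAbs ≤ τ) ∨ (∀ ν, (rel B.tgt c ν).natAbs ≤ τ))).card ≤
      2 * P.d * (2 * τ + 1) ^ P.d := by
  classical
  set box : Finset (Site P j) := univ.filter (fun s : Site P j => ∀ κ, (rel c s κ).natAbs ≤ τ) with hbox
  have hcard : box.card ≤ (2 * τ + 1) ^ P.d := card_box_le c τ
  -- sources in the box
  have hS : (univ.filter (fun B : PBond P j => ∀ ν, (rel B.src c ν).natAbs ≤ τ)).card ≤ P.d * (2 * τ + 1) ^ P.d := by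
    have hsub : univ.filter (fun B : PBond P j => ∀ ν, (rel B.src c ν).natAbs ≤ τ) ⊆
        (box ×ˢ (univ : Finset (Fin P.d))).image (fun p => (⟨p.1, p.2⟩ : PBond P j)) := by
      intro B hB
      rw [mem_filter] at hB
      rw [mem_image]
      refine ⟨(B.src, B.dir), ?_, rfl⟩
      rw [mem_product]
      refine ⟨?_, mem_univ _⟩
      rw [hbox, mem_filter]
      exact ⟨mem_univ _, fun κ => by rw [natAbs_rel_comm]; exact hB.2 κ⟩
    refine (card_le_card hsub).trans (card_image_le.trans ?_)
    rw [card_product, card_univ, Fintype.card_fin]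
    calc box.card * P.d ≤ (2 * τ + 1) ^ P.d * P.d := Nat.mul_le_mul_right _ hcard
      _ = P.d * (2 * τ + 1) ^ P.d := Nat.mul_comm _ _
  -- targets in the box (`B.src = B.tgt − e_dir`)
  have hT : (univ.filter (fun B : PBond P j => ∀ ν, (rel B.tgt c ν).natAbs ≤ τ)).card ≤ P.d * (2 * τ + 1) ^ P.d := by
    have hsub : univ.filter (fun B : PBond P j => ∀ ν, (rel B.tgt c ν).natAbs ≤ τ) ⊆
        (box ×ˢ (univ : Finset (Fin P.d))).image (fun p => (⟨p.1.unshift p.2, p.2⟩ : PBond P j)) := by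
      intro B hB
      rw [mem_filter] at hB
      rw [mem_image]
      refine ⟨(B.tgt, B.dir), ?_, ?_⟩
      · rw [mem_product]
        refine ⟨?_, mem_univ _⟩
        rw [hbox, mem_filter]
        exact ⟨mem_univ _, fun κ => by rw [natAbs_rel_comm]; exact hB.2 κ⟩
      · obtain ⟨s, μ⟩ := B
        show (⟨(s.shift μ).unshift μ, μ⟩ : PBond P j) = ⟨s, μ⟩
        rw [unshift_shift]
    refine (card_le_card hsub).trans (card_image_le.trans ?_)
    rw [card_product, card_univ, Fintype.card_fin]
    calc box.card * P.d ≤ (2 * τ + 1) ^ P.d * P.d := Nat.mul_le_mul_right _ hcard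
      _ = P.d * (2 * τ + 1) ^ P.d := Nat.mul_comm _ _
  rw [filter_or]
  calc _ ≤ _ := card_union_le _ _
    _ ≤ P.d * (2 * τ + 1) ^ P.d + P.d * (2 * τ + 1) ^ P.d := Nat.add_le_add hS hT
    _ = 2 * P.d * (2 * τ + 1) ^ P.d := by ring

end Torus

/-! ## §2 The cover: block-pair boxes of the READ′ bonds are read by the READ′ sets of the top bonds within distance 3 -/

section Cover

variable {F : T3Family}

/-- ★★★ **BLOCK-PAIR READ COVER** ((k2) of ARCHITECT px17 g22 2026-08-31 22:05:02Z): for ANY bond function `f` at level `J+t+1`,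
`Σ_B ‖𝟙[BOX_t(B)]·f‖² ≤ (2·d·7^d)·Σ_B ‖𝟙[READ′_t(B)]·f‖²`, where `READ′_t(B)` is the stations' thickened read set (✓p830803∕✓p831146∕✓p834059 text
VERBATIM) and `BOX_t(B)` = «the block of the bond is the block of a `READ′_t(B)` bond or one of its two neighbours along that bond's direction» (px16 g24's W-ρκ
box, px20's `discRow'` currency).  With `f` := the station's relative log field this is `Σ_B δC(t,B)² ≤ C_adj·E′lam t` — the feedback column's `S′`-share.
Mechanism: every box bond `ℓ′` is read by the top bond `B′ = ⟨σ⁻¹(blockIter (t+1) ℓ′.src), 0⟩` (witness `z := ℓ′.src`), which lies within sup-distance `3` of an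
endpoint of `B` (§1); at most `2·d·7^d` bonds `B` have an endpoint within `3` of a given site. [cite: Balaban1987RG1, (0.1)-(0.4) p.251-253; Balaban1985Averaging, Prop. 4 (128)-(135) p.37-38] -/
theorem sum_sq_boxSup_le_readSup {E : Type*} [SeminormedAddCommGroup E] (J t : ℕ) (f : PBond (F.P (J + (t + 1))) 0 → E) :
    ∑ B : PBond (F.P J) 0, ‖(fun ℓ' : PBond (F.P (J + (t + 1))) 0 =>
        if ∃ ℓ'' : PBond (F.P (J + (t + 1))) 0, (∃ z : Site (F.P (J + (t + 1))) 0,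
                (B14.Eq22Determines.blockIter (t + 1) z = (bondShift (F.sitesPerDir_eq (m := F.m) (K := J) (j := 0) (m' := F.m) (K' := J + (t + 1)) (j' := t + 1) (by omega)) B).src ∨ B14.Eq22Determines.blockIter (t + 1) z = (bondShift (F.sitesPerDir_eq (m := F.m) (K := J) (j := 0) (m' := F.m) (K' := J + (t + 1)) (j' := t + 1) (by omega)) B).tgt) ∧
                ∀ ν, (B10Eq27TorusAxialLog.rel z ℓ''.src ν).natAbs ≤ 2) ∧
                (blockOf ℓ'.src = (blockOf ℓ''.src).unshift ℓ''.dir ∨ blockOf ℓ'.src = blockOf ℓ''.src ∨ blockOf ℓ'.src = (blockOf ℓ''.src).shift ℓ''.dir)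
        then f ℓ' else 0)‖ ^ 2 ≤
      ((2 * (F.P J).d * 7 ^ (F.P J).d : ℕ) : ℝ) * ∑ B : PBond (F.P J) 0, ‖(fun ℓ' : PBond (F.P (J + (t + 1))) 0 =>
        if ∃ z : Site (F.P (J + (t + 1))) 0,
                (B14.Eq22Determines.blockIter (t + 1) z = (bondShift (F.sitesPerDir_eq (m := F.m) (K := J) (j := 0) (m' := F.m) (K' := J + (t + 1)) (j' := t + 1) (by omega)) B).src ∨ B14.Eq22Determines.blockIter (t + 1) z = (bondShift (F.sitesPerDir_eq (m := F.m) (K := J) (j := 0) (m' := F.m) (K' := J + (t + 1)) (j' := t + 1) (by omega)) B).tgt) ∧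
                ∀ ν, (B10Eq27TorusAxialLog.rel z ℓ'.src ν).natAbs ≤ 2
        then f ℓ' else 0)‖ ^ 2 := by
  classical
  -- the level identification and the standing range at level `J+t+1`
  have P₁ : (F.P J).sitesPerDir 0 = (F.P (J + (t + 1))).sitesPerDir (t + 1) := F.sitesPerDir_eq (by omega)
  have htK : t + 1 ≤ (F.P (J + (t + 1))).m + (F.P (J + (t + 1))).K := by show t + 1 ≤ F.m + (J + (t + 1)); omega
  have hd : 0 < (F.P J).d := (F.P J).hd
  -- the READ′ Pi-sups
  set R : PBond (F.P J) 0 → ℝ := fun B' => ‖(fun ℓ' : PBond (F.P (J + (t + 1))) 0 =>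
        if ∃ z : Site (F.P (J + (t + 1))) 0,
                (B14.Eq22Determines.blockIter (t + 1) z = (bondShift (F.sitesPerDir_eq (m := F.m) (K := J) (j := 0) (m' := F.m) (K' := J + (t + 1)) (j' := t + 1) (by omega)) B').src ∨ B14.Eq22Determines.blockIter (t + 1) z = (bondShift (F.sitesPerDir_eq (m := F.m) (K := J) (j := 0) (m' := F.m) (K' := J + (t + 1)) (j' := t + 1) (by omega)) B').tgt) ∧
                ∀ ν, (B10Eq27TorusAxialLog.rel z ℓ'.src ν).natAbs ≤ 2
        then f ℓ' else 0)‖ with hR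
  have hR0 : ∀ B', 0 ≤ R B' := fun B' => norm_nonneg _
  -- adjacency: `B′.dir = 0` and `B′.src` within `3` of an endpoint of `B`
  let adj : PBond (F.P J) 0 → PBond (F.P J) 0 → Prop := fun B B' =>
    B'.dir = ⟨0, hd⟩ ∧ ((∀ ν, (rel B.src B'.src ν).natAbs ≤ 3) ∨ (∀ ν, (rel B.tgt B'.src ν).natAbs ≤ 3))
  -- STEP 1: per `B`, the box sup is read by the adjacent top bonds
  have h1 : ∀ B : PBond (F.P J) 0, ‖(fun ℓ' : PBond (F.P (J + (t + 1))) 0 =>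
        if ∃ ℓ'' : PBond (F.P (J + (t + 1))) 0, (∃ z : Site (F.P (J + (t + 1))) 0,
                (B14.Eq22Determines.blockIter (t + 1) z = (bondShift (F.sitesPerDir_eq (m := F.m) (K := J) (j := 0) (m' := F.m) (K' := J + (t + 1)) (j' := t + 1) (by omega)) B).src ∨ B14.Eq22Determines.blockIter (t + 1) z = (bondShift (F.sitesPerDir_eq (m := F.m) (K := J) (j := 0) (m' := F.m) (K' := J + (t + 1)) (j' := t + 1) (by omega)) B).tgt) ∧
                ∀ ν, (B10Eq27TorusAxialLog.rel z ℓ''.src ν).natAbs ≤ 2) ∧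
                (blockOf ℓ'.src = (blockOf ℓ''.src).unshift ℓ''.dir ∨ blockOf ℓ'.src = blockOf ℓ''.src ∨ blockOf ℓ'.src = (blockOf ℓ''.src).shift ℓ''.dir)
        then f ℓ' else 0)‖ ^ 2 ≤ ∑ B' ∈ univ.filter (adj B), R B' ^ 2 := by
    intro B
    set S : ℝ := ∑ B' ∈ univ.filter (adj B), R B' ^ 2 with hS
    have hS0 : 0 ≤ S := sum_nonneg fun B' _ => sq_nonneg _
    suffices hsup : ‖(fun ℓ' : PBond (F.P (J + (t + 1))) 0 =>
        if ∃ ℓ'' : PBond (F.P (J + (t + 1))) 0, (∃ z : Site (F.P (J + (t + 1))) 0,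
                (B14.Eq22Determines.blockIter (t + 1) z = (bondShift (F.sitesPerDir_eq (m := F.m) (K := J) (j := 0) (m' := F.m) (K' := J + (t + 1)) (j' := t + 1) (by omega)) B).src ∨ B14.Eq22Determines.blockIter (t + 1) z = (bondShift (F.sitesPerDir_eq (m := F.m) (K := J) (j := 0) (m' := F.m) (K' := J + (t + 1)) (j' := t + 1) (by omega)) B).tgt) ∧
                ∀ ν, (B10Eq27TorusAxialLog.rel z ℓ''.src ν).natAbs ≤ 2) ∧
                (blockOf ℓ'.src = (blockOf ℓ''.src).unshift ℓ''.dir ∨ blockOf ℓ'.src = blockOf ℓ''.src ∨ blockOf ℓ'.src = (blockOf ℓ''.src).shift ℓ''.dir)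
        then f ℓ' else 0)‖ ≤ Real.sqrt S by
      calc _ ≤ Real.sqrt S ^ 2 := pow_le_pow_left₀ (norm_nonneg _) hsup 2
        _ = S := Real.sq_sqrt hS0
    refine (pi_norm_le_iff_of_nonneg (Real.sqrt_nonneg S)).mpr fun ℓ' => ?_
    by_cases hb : ∃ ℓ'' : PBond (F.P (J + (t + 1))) 0, (∃ z : Site (F.P (J + (t + 1))) 0,
                (B14.Eq22Determines.blockIter (t + 1) z = (bondShift (F.sitesPerDir_eq (m := F.m) (K := J) (j := 0) (m' := F.m) (K' := J + (t + 1)) (j' := t + 1) (by omega)) B).src ∨ B14.Eq22Determines.blockIter (t + 1) z = (bondShift (F.sitesPerDir_eq (m := F.m) (K := J) (j := 0) (m' := F.m) (K' := J + (t + 1)) (j' := t + 1) (by omega)) B).tgt) ∧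
                ∀ ν, (B10Eq27TorusAxialLog.rel z ℓ''.src ν).natAbs ≤ 2) ∧
                (blockOf ℓ'.src = (blockOf ℓ''.src).unshift ℓ''.dir ∨ blockOf ℓ'.src = blockOf ℓ''.src ∨ blockOf ℓ'.src = (blockOf ℓ''.src).shift ℓ''.dir)
    · rw [if_pos hb]
      obtain ⟨ℓ'', ⟨z, hzB, hz2⟩, hbox⟩ := hb
      -- the reading top bond
      let y₀ : Site (F.P (J + (t + 1))) (t + 1) := B14.Eq22Determines.blockIter (t + 1) ℓ'.src
      let B₀ : PBond (F.P J) 0 := ⟨(siteShift P₁).symm y₀, ⟨0, hd⟩⟩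
      have hsrc : (bondShift P₁ B₀).src = y₀ := by
        rw [bondShift_src]; exact (siteShift P₁).apply_symm_apply y₀
      -- `ℓ′ ∈ READ′_t(B₀)` with witness `ℓ′.src`
      have hread : ∃ z : Site (F.P (J + (t + 1))) 0,
                (B14.Eq22Determines.blockIter (t + 1) z = (bondShift (F.sitesPerDir_eq (m := F.m) (K := J) (j := 0) (m' := F.m) (K' := J + (t + 1)) (j' := t + 1) (by omega)) B₀).src ∨ B14.Eq22Determines.blockIter (t + 1) z = (bondShift (F.sitesPerDir_eq (m := F.m) (K := J) (j := 0) (m' := F.m) (K' := J + (t + 1)) (j' := t + 1) (by omega)) B₀).tgt) ∧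
                ∀ ν, (B10Eq27TorusAxialLog.rel z ℓ'.src ν).natAbs ≤ 2 :=
        ⟨ℓ'.src, Or.inl hsrc.symm, fun ν => by rw [rel_self]; simp⟩
      have hle : ‖f ℓ'‖ ≤ R B₀ := by
        have := norm_le_pi_norm (fun ℓ' : PBond (F.P (J + (t + 1))) 0 =>
          if ∃ z : Site (F.P (J + (t + 1))) 0,
                (B14.Eq22Determines.blockIter (t + 1) z = (bondShift (F.sitesPerDir_eq (m := F.m) (K := J) (j := 0) (m' := F.m) (K' := J + (t + 1)) (j' := t + 1) (by omega)) B₀).src ∨ B14.Eq22Determines.blockIter (t + 1) z = (bondShift (F.sitesPerDir_eq (m := F.m) (K := J) (j := 0) (m' := F.m) (K' := J + (t + 1)) (j' := t + 1) (by omega)) B₀).tgt) ∧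
                ∀ ν, (B10Eq27TorusAxialLog.rel z ℓ'.src ν).natAbs ≤ 2
          then f ℓ' else 0) ℓ'
        rwa [if_pos hread] at this
      -- `B₀` is adjacent to `B`
      have hadj : adj B B₀ := by
        refine ⟨rfl, ?_⟩
        have hdist : ∀ ν, (rel (B14.Eq22Determines.blockIter (t + 1) z) y₀ ν).natAbs ≤ 3 := fun ν =>
          natAbs_rel_blockIter_le_three_of_box (by omega) htK z ℓ''.src ℓ'.src ℓ''.dir hz2 hbox ν
        rcases hzB with hz | hz
        · left
          intro ν
          have hzs : B14.Eq22Determines.blockIter (t + 1) z = siteShift P₁ B.src := hz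
          have e := natAbs_rel_siteShift P₁ B.src ((siteShift P₁).symm y₀) ν
          rw [(siteShift P₁).apply_symm_apply, ← hzs] at e
          exact e.symm.le.trans (hdist ν)
        · right
          intro ν
          have hzt : B14.Eq22Determines.blockIter (t + 1) z = siteShift P₁ B.tgt := hz.trans (bondShift_tgt P₁ B)
          have e := natAbs_rel_siteShift P₁ B.tgt ((siteShift P₁).symm y₀) ν
          rw [(siteShift P₁).apply_symm_apply, ← hzt] at e
          exact e.symm.le.trans (hdist ν)
      have hmem : B₀ ∈ univ.filter (adj B) := by rw [mem_filter]; exact ⟨mem_univ _, hadj⟩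
      have hsq : R B₀ ^ 2 ≤ S := by
        rw [hS]
        exact single_le_sum (f := fun B' => R B' ^ 2) (fun B' _ => sq_nonneg (R B')) hmem
      calc ‖f ℓ'‖ ≤ R B₀ := hle
        _ ≤ Real.sqrt S := (Real.le_sqrt (hR0 B₀) hS0).mpr hsq
    · rw [if_neg hb, norm_zero]
      exact Real.sqrt_nonneg S
  -- STEP 2: the double count
  have hcard : ∀ B' : PBond (F.P J) 0, ((univ.filter (fun B : PBond (F.P J) 0 => adj B B')).card : ℝ) ≤ ((2 * (F.P J).d * 7 ^ (F.P J).d : ℕ) : ℝ) := by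
    intro B'
    have hsub : univ.filter (fun B : PBond (F.P J) 0 => adj B B') ⊆
        univ.filter (fun B : PBond (F.P J) 0 => (∀ ν, (rel B.src B'.src ν).natAbs ≤ 3) ∨ (∀ ν, (rel B.tgt B'.src ν).natAbs ≤ 3)) := by
      intro B hB
      rw [mem_filter] at hB ⊢
      exact ⟨hB.1, hB.2.2⟩
    have h := (card_le_card hsub).trans (card_bonds_nearBox_le B'.src 3)
    exact_mod_cast h
  calc ∑ B : PBond (F.P J) 0, ‖(fun ℓ' : PBond (F.P (J + (t + 1))) 0 =>
        if ∃ ℓ'' : PBond (F.P (J + (t + 1))) 0, (∃ z : Site (F.P (J + (t + 1))) 0,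
                (B14.Eq22Determines.blockIter (t + 1) z = (bondShift (F.sitesPerDir_eq (m := F.m) (K := J) (j := 0) (m' := F.m) (K' := J + (t + 1)) (j' := t + 1) (by omega)) B).src ∨ B14.Eq22Determines.blockIter (t + 1) z = (bondShift (F.sitesPerDir_eq (m := F.m) (K := J) (j := 0) (m' := F.m) (K' := J + (t + 1)) (j' := t + 1) (by omega)) B).tgt) ∧
                ∀ ν, (B10Eq27TorusAxialLog.rel z ℓ''.src ν).natAbs ≤ 2) ∧
                (blockOf ℓ'.src = (blockOf ℓ''.src).unshift ℓ''.dir ∨ blockOf ℓ'.src = blockOf ℓ''.src ∨ blockOf ℓ'.src = (blockOf ℓ''.src).shift ℓ''.dir)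
        then f ℓ' else 0)‖ ^ 2
      ≤ ∑ B : PBond (F.P J) 0, ∑ B' ∈ univ.filter (adj B), R B' ^ 2 := sum_le_sum fun B _ => h1 B
    _ = ∑ B : PBond (F.P J) 0, ∑ B' : PBond (F.P J) 0, (if adj B B' then R B' ^ 2 else 0) := by
        refine sum_congr rfl fun B _ => ?_
        rw [sum_filter]
    _ = ∑ B' : PBond (F.P J) 0, ∑ B : PBond (F.P J) 0, (if adj B B' then R B' ^ 2 else 0) := sum_comm
    _ = ∑ B' : PBond (F.P J) 0, ((univ.filter (fun B : PBond (F.P J) 0 => adj B B')).card : ℝ) * R B' ^ 2 := by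
        refine sum_congr rfl fun B' _ => ?_
        rw [← sum_filter, sum_const, nsmul_eq_mul]
    _ ≤ ∑ B' : PBond (F.P J) 0, ((2 * (F.P J).d * 7 ^ (F.P J).d : ℕ) : ℝ) * R B' ^ 2 :=
        sum_le_sum fun B' _ => mul_le_mul_of_nonneg_right (hcard B') (sq_nonneg _)
    _ = ((2 * (F.P J).d * 7 ^ (F.P J).d : ℕ) : ℝ) * ∑ B' : PBond (F.P J) 0, R B' ^ 2 := by rw [mul_sum]

end Cover

end Summit.QuantumFields.YangMills.Theorems.FluctuationComparisonRegPrIntLS2BetaBlockPairReadCover
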